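import Mathlib.Algebra.MvPolynomial.Division
import Mathlib.Algebra.MvPolynomial.CommRing
import Mathlib.RingTheory.MvPolynomial.Basic
import Mathlib.RingTheory.Ideal.Maps
import Mathlib.RingTheory.Ideal.Colon
import HarnessLib

/-!
# Hu 2025 (arXiv:2507.21400v1), §5.1 «Some conventions on blowups» — Def. 5.1, Def. 5.2, Prop. 5.3, Def. 5.4,
# Lem. 5.5, Def. 5.6: statements-first typing, interface I-CH of lit/PARTITION-HU.md row 106
# (file `S05ThetaBlowups/R106aCharts.lean`) — FILED by res-type-023 (gen 9) as row-106 owner per the M-Hu re-pointing line 2026-08-27T08:00:07Z (director-resolution g4, M-Hu-min OPEN; REPOINT LIST OF RECORD res-dag-1 04:27Z); T9: every locator re-read on the chunks in this seat 2026-08-27T05:4xZ; pre-drafts g4–g9 under HOME/plan/tools/res-type-023/hu/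

**STATUS OF THE SOURCE (D-0012 / D-0089): UNREFEREED PREPRINT UNDER ADJUDICATION.** Y. Hu, *Universal
Characteristic-free Resolution of Singularities, I*, arXiv:2507.21400v1 (2025-07-29, 162 pp.) [Hu2025]; held as
`paper:arxiv-2507.21400` = the arXiv TeX source in 73 chunks; LOCATOR OF RECORD = chunk + line `C<cc>L<l>`
(lit/PARTITION-HU.md §0), next to it the arXiv PDF page «p.N». HONEST CEILING (PARTITION-HU header): Part I claims
resolution of singularity TYPES (Thm 1.1); the summit-type claim rests on the unposted Part II. Statements below are
`def … : Prop` CANDIDATES tagged `[claim: Hu2025, status: under-review]` — «STATUS: candidate statement under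
adjudication (D-0012/D-0089); not asserted»; nothing is proved, nothing is asserted, no declaration takes a side.
AI typing, weaker than expert review.

## Carrier level (PARTITION-HU §1 «CARRIER LEVEL (binding recommendation)»)
Everything in §5.1 is typed INSIDE ONE AFFINE CHART over commutative algebra: a (standard) chart `𝔙'` is a
polynomial ring `R[Var_𝔙']` in a set of free variables indexed by a type `V`; the chart `𝔙 = (𝔙' × (ξ_i ≡ 1)) ∩ X̃`
of the blow-up along the coordinate subspace `Z = {y'_0 = ⋯ = y'_m = 0}` (Def. 5.1/5.2) has free variables
`Var_𝔙 = {ζ, y_1, …, y_m} ∪ {y : y' ∈ Var_𝔙' ∖ {y'_0,…,y'_m}}` (Prop. 5.3), in CANONICAL BIJECTION with `Var_𝔙'`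
(`y'_i ↦ y_i`, `y'_{i₀} ↦ ζ`, `y' ↦ y`) — exactly as the charts of `ℛ̃_{ϑ[k]}` keep the index set
`𝕀^⋆_{3,n} ⊔ Λ^⋆_𝔉` at every stage and only re-LABEL variables (Prop. 5.11, C37L46–L53). So the index type `V`
is FIXED along a blow-up step and the step is an `R`-algebra endomorphism `π^*_{𝔙,𝔙'}` of `R[V]` (Def. 5.4,
C35L24–L29: «we substitute y'_i by y'_0 ξ_i … and switch y_0' by ζ and ξ_i by y_i»). The base ring `R` is any
commutative ring (Hu: «the base field 𝕜», C34L15–L16; `𝔽 = ℚ or 𝔽_p` in §8, C67L4) — statements needing a field say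
so. Scheme-level objects (X̃ ⊂ X × ℙ^m, the exceptional DIVISOR, closed points) appear through their chart ideals:
closed point of the chart ↦ maximal ideal of `R[V]` (Def. 5.6).

## Items ↦ declarations (FQ prefix `Literature.AlgebraicGeometry.Hu2025.Statements.S05ThetaBlowups.`)
* §5.1 conventions C34L14–L50 (blow-up realised in `X × ℙ^m`; (general-blowup) C34L27–L36; (general-blowup-formulas)
  C34L48–L50 «f_i ξ_j − f_j ξ_i») — prose conventions, carried by the docstrings of `ChartStep` / `ChartStep.pullback`.
* Def. 5.1 C34L69–L98; p.79 (standard charts of X̃ lying over charts of X; «lies over» along a sequence) ↦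
  `ChartStep` (one blow-up step seen from a chart), `ChartSeq` / `ChartSeq.pullback` (a standard chart of X̃_k over a
  root chart = a word of steps; «lies over» = prefix), `Def5_1` (anchor Prop: ζ generates the total transform of the
  centre ideal on the chart — the content of «𝔙 = (𝔙' × (ξ_i ≡ 1)) ∩ X̃» at ring level, = Prop. 5.3 first bullet).
* Def. 5.2 C34L106–L116; p.79 ↦ `ChartStep.IsProperTransformVar` (over `ChartStep.strictTransform` = the honest
  strict transform of an ideal on the chart: ζ-saturation of the total transform; OURS VOCABULARY, standard —
  tree anchor `Literature.AlgebraicGeometry.Resolution.MarkedIdeals.strictTransformIdeal` (scheme level)).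
* (general-blowup-formulas instance) C34L131–L142 «𝔙 … is defined [by] y'_i − y'_0 ξ_i» ↦ `ChartStep.pullback`.
* Prop. 5.3 C34L146–C35L5; p.80 ↦ `ChartStep.excVar` (ζ), `Prop5_3`.
* Def. 5.4 C35L13–L49; p.80 ↦ `phiDeg` (m_{φ,T}), `lPhi` (l_{φ,B}), `Binomial`, `ChartStep.pullbackExp`,
  `Def5_4` (= `ChartStep.properTransform`, the binomial case AS PRINTED: divide the pull-back by ζ^{l_{φ,B}}),
  `Def5_4_poly` (general f: «f_𝔙 = π^* f … we also call f_𝔙 the proper transform», AS PRINTED = the pull-back),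
  `Def5_4_ours` (OURS sibling T5/§6(e): the strict transform of the IDEAL generated by a set of equations — what
  joint J3 = G-H2 reads next to `Def5_4`), `ChartStep.AcquiredBy` («ζ is acquired by y'_i», C35L44–L49).
* Lem. 5.5 C35L51–L63; p.81 ↦ `Lem5_5`.
* Def. 5.6 C35L65–L76; p.81 ↦ `Binomial.TerminatesAt` (= `Def5_6`).
Out of scope here (row 106 files b/c, owner): Def. 5.7–5.9, Prop. 5.10–5.12, Def. 5.13–5.15, Prop. 5.16, Cor. 5.17/5.18,
Def. 5.19, Rem. 5.20 (they EXTEND this interface with the ϑ-specific index sets).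

## Rendering choices (for the lanes; each is a choice, none takes a side)
* WLOG `i = 0` (C34L131 «Without loss of generality, we assume that the standard chart 𝔙 corresponds to (ξ_0 ≡ 1)»)
  is typed as the general chart index `exc ∈ centre` — no generality lost or added.
* Binomials are pairs of MONIC monomials `𝐦 − 𝐦'` (Hu §4.2 C22L5–L6 «it suffices to consider binomials 𝐦 − 𝐦'»;
  Def. 5.4 «B_𝔙' = T⁰_𝔙' − T¹_𝔙'»): `Binomial V` = two exponent vectors; `Binomial.toPoly`.
* Def. 5.4's division by `ζ^{l_{φ,B}}` is typed on EXPONENTS (`properTransform`, exact) and on polynomials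
  (`properTransformPoly`, Mathlib `MvPolynomial.divMonomial`); that the two agree, and that `ζ^{l_{φ,B}}` is the exact
  power of ζ dividing `π^* B` for `T⁰ ≠ T¹`, are kernel facts NOT stated here (T3).
* «closed point 𝐳 ∈ 𝔙» (Def. 5.6) ↦ a maximal ideal of `R[V]` (for `R` a field not algebraically closed the closed
  points of the chart are not `R`-rational; the typed form covers both); «T does not vanish at 𝐳» ↦ `T ∉ 𝔪`.
-/

noncomputable section

open MvPolynomial

namespace Literature.AlgebraicGeometry.Hu2025.Statements.S05ThetaBlowups

universe u v

variable (R : Type u) [CommRing R] {V : Type v} [DecidableEq V]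

/-! ## Def. 5.1 / Def. 5.2 — one blow-up step seen from a standard chart -/

/-- **The data of one blow-up step on a standard chart (Def. 5.1 C34L69–L86, p.79; standing assumption after
Def. 5.2, C34L116–L129, p.79–80; WLOG C34L131–L135).** C34L118–L127: «We assume in addition that the induced blowup
morphism π⁻¹(𝔙') ⟶ 𝔙' corresponds to the blowup of 𝔙' along the coordinate subspace of 𝔙' defined by
Z = {y'_0 = ⋯ = y'_m = 0} with {y'_0, ⋯, y'_m} ⊂ Var_𝔙'»; Def. 5.1 C34L73–L85: «Fix any 0 ≤ i ≤ m. We let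
𝔙 = (𝔙' × (ξ_i ≠ 0)) ∩ X̃. We also often express this chart as 𝔙 = (𝔙' × (ξ_i ≡ 1)) ∩ X̃. It is an open subset of X̃,
and will be called a standard chart of X̃ lying over the (standard) chart 𝔙' of X»; C34L131–L135 «Without loss of
generality, we assume that the standard chart 𝔙 corresponds to (ξ_0 ≡ 1)».
Typed: `centre` = the index set `{y'_0,…,y'_m} ⊆ Var_𝔙'` of the centre's coordinates, `exc` = the chosen index
`i` (printed WLOG `0`) whose variable becomes the exceptional variable ζ on 𝔙 (Prop. 5.3 «ζ := y_0'»). The variable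
index type `V` is the same for 𝔙' and 𝔙 (module docstring, «Carrier level»).
[claim: Hu2025, status: under-review]
STATUS: candidate statement under adjudication (D-0012/D-0089); not asserted. -/
structure ChartStep (V : Type v) where
  /-- the coordinates `{y'_0, …, y'_m} ⊂ Var_𝔙'` cutting out the centre `Z` (C34L122–L127; `φ` of Def. 5.4, C35L15–L17) -/
  centre : Finset V
  /-- the index `i` of the chart `(ξ_i ≡ 1)` (Def. 5.1 C34L73–L81); its variable is renamed `ζ` on `𝔙` (Prop. 5.3 C34L153 «ζ := y_0'») -/
  exc : V
  /-- `i ∈ {0, …, m}` (C34L73 «Fix any 0 ≤ i ≤ m») -/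
  exc_mem : exc ∈ centre

namespace ChartStep

variable {R}
variable (s : ChartStep V)

/-- **The exceptional variable `ζ` of the step on the chart `𝔙` (Prop. 5.3, C34L149–L157; p.80).** C34L153 «ζ := y_0'»
and C34L157 «E ∩ 𝔙 = (ζ = 0); we call ζ the exceptional variable/parameter of E on 𝔙». Typed: the variable of index
`exc`.
[claim: Hu2025, status: under-review]
STATUS: candidate statement under adjudication (D-0012/D-0089); not asserted. -/
def excVar : MvPolynomial V R := X s.exc

/-- **The pull-back `π^*_{𝔙,𝔙'} : R[Var_𝔙'] → R[Var_𝔙]` of the step (Def. 5.4, C35L26–L29, p.80; the chart equations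
C34L137–L142 «we have that 𝔙, as a closed subscheme of 𝔙' × (ξ_0 ≡ 1), is defined [by] y'_i − y'_0 ξ_i, for all
i ∈ [m]», p.80; (general-blowup-formulas) C34L46–L50 «f_i ξ_j − f_j ξ_i, for all 0 ≤ i ≠ j ≤ m», p.79).** «Applying (general-blowup-formulas), we substitute
y'_i by y'_0 ξ_i, for all i ∈ [m], into B_𝔙' and switch y_0' by ζ and ξ_i by y_i with i ∈ [m] to obtain the pullback
π^*_{𝔙,𝔙'} B_𝔙' where π_{𝔙,𝔙'} : 𝔙 ⟶ 𝔙' is the induced projection.» Typed as the `R`-algebra endomorphism of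
`R[V]`: `X_{exc} ↦ X_{exc}` (= ζ), `X_j ↦ X_{exc} · X_j` for `j ∈ centre`, `j ≠ exc`, and `X_y ↦ X_y` for
`y ∉ centre` (Prop. 5.3: «y := y'»).
[claim: Hu2025, status: under-review]
STATUS: candidate statement under adjudication (D-0012/D-0089); not asserted. -/
def pullback : MvPolynomial V R →ₐ[R] MvPolynomial V R :=
  MvPolynomial.aeval fun j => if j ∈ s.centre ∧ j ≠ s.exc then X s.exc * X j else X j

/-- **Strict transform of an ideal on the chart (OURS VOCABULARY — the standard notion, not a printed definition;
used to TYPE Def. 5.2's «proper transform of the divisor» and the sibling `Def5_4_ours`).** For an ideal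
`I ⊆ R[Var_𝔙']`, the ζ-saturation of its total transform: `⋃ₙ (π^* I · R[Var_𝔙] : ζⁿ)` — the ideal of the
scheme-theoretic closure of `π⁻¹(V(I) ∖ Z) ∩ 𝔙` when `R` is a field. Tree anchor (scheme level):
`Literature.AlgebraicGeometry.Resolution.MarkedIdeals.strictTransformIdeal` [cite: GortzWedhorn2020, (13.19)];
lit/PARTITION-HU.md §1c names exactly this ring-level form. Labelled OURS: [Hu25] §5.1 uses «proper transform» of
divisors/schemes (C34L113–L114, C35L36, C36L133, C37L3–L10) as a known notion, without a printed definition; this is the reading the adjudication of joint J3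
(G-H2) compares with Def. 5.4's term-wise operation.
[claim: Hu2025, status: under-review]
STATUS: candidate statement under adjudication (D-0012/D-0089); not asserted — OURS vocabulary (standard notion, not a printed definition). -/
def strictTransform (I : Ideal (MvPolynomial V R)) : Ideal (MvPolynomial V R) :=
  ⨆ n : ℕ, (I.map (s.pullback (R := R))).colon ({s.excVar (R := R) ^ n} : Set (MvPolynomial V R))

/-- **Definition 5.2 (C34L106–L114; p.79).** «Assume that the open chart 𝔙 (resp. 𝔙') comes equipped with a set of
local free variables in Var_𝔙 (resp. Var_𝔙'). Let y ∈ Var_𝔙 (resp. y' ∈ Var_𝔙') be a local free variable of 𝔙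
(resp. 𝔙'). We say the local free variable y is a proper transform of the local free variable y' if the divisor
(y = 0) on the chart 𝔙 is the proper transform of the divisor (y' = 0) on the chart 𝔙'.» Typed at ring level with
«proper transform of the divisor» = strict transform of its ideal (`strictTransform`, OURS vocabulary): the ideal
`(X_y)` of `R[Var_𝔙]` equals the strict transform of the ideal `(X_{y'})` of `R[Var_𝔙']`.
[claim: Hu2025, status: under-review]
STATUS: candidate statement under adjudication (D-0012/D-0089); not asserted. -/
def IsProperTransformVar (y y' : V) : Prop :=
  Ideal.span {(X y : MvPolynomial V R)} = s.strictTransform (R := R) (Ideal.span {X y'})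

end ChartStep

/-- **Definition 5.2 under its printed name:** `Def5_2 R s y y'` = «the variable of index `y` on `𝔙` is a proper
transform of the variable of index `y'` on `𝔙'`» (C34L106–L114; p.79). Alias of `ChartStep.IsProperTransformVar`.
[claim: Hu2025, status: under-review]
STATUS: candidate statement under adjudication (D-0012/D-0089); not asserted. -/
abbrev Def5_2 (s : ChartStep V) (y y' : V) : Prop := s.IsProperTransformVar (R := R) y y'

/-- **Definition 5.1, the chart relation at ring level (C34L69–L86 with C34L137–L142; p.79–80) — anchor Prop.**
Content of «𝔙 = (𝔙' × (ξ_i ≡ 1)) ∩ X̃» (C34L81) read on the coordinate rings: on the chart `𝔙` the total transform of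
the centre ideal `(y'_0, …, y'_m)` is the principal ideal of the exceptional variable, `π^*(y'_0,…,y'_m) · R[Var_𝔙] = (ζ)`
(= Prop. 5.3 first bullet, C34L147 «we let E be the exceptional divisor of the blowup X̃ → X» and C34L157
«E ∩ 𝔙 = (ζ = 0)»). Typed for every step `s`. (On the typed carrier this holds for every step by construction of `ChartStep.pullback` — a model-consistency statement, not a constraint on the step; kernel check in `Proofs/S05ThetaBlowups/Charts.lean`; lane-B pre-read N1 2026-08-27T06:53Z.)
[claim: Hu2025, status: under-review]
STATUS: candidate statement under adjudication (D-0012/D-0089); not asserted. -/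
def Def5_1 (s : ChartStep V) : Prop :=
  (Ideal.span ((fun j => (X j : MvPolynomial V R)) '' (s.centre : Set V))).map (s.pullback (R := R)) =
    Ideal.span {s.excVar (R := R)}

/-- **Standard charts along a sequence of blow-ups (Def. 5.1, second half, C34L88–L99; p.79).** «In general, we let
X̃_k ⟶ X̃_{k−1} ⟶ ⋯ ⟶ X̃_0 := X be a sequence of blowups such that every blowup X̃_j → X̃_{j−1} is as in
(general-blowup) … Let 𝔙 (resp. 𝔙'') be a standard chart of X̃_k (resp. of X̃_j) … Via induction, we say 𝔙 lies over
𝔙'' if 𝔙' equals to (when j = k−1) or lies over 𝔙'' (when j < k−1).» Typed: a standard chart of `X̃_k` lying over a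
fixed root chart of `X` is recorded by the word of its `k` steps (root first); a chart of `X̃_j` it lies over is a
prefix (`ChartSeq.LiesOver`). (A step whose centre does not meet the chart: Prop. 5.11 proof C37L110–L116 «𝔙' does
not intersect the proper transform of the blowup center … 𝔙 → 𝔙' is an isomorphism. In this case, we let
Var_𝔙 = Var_𝔙'» — the owner of files 106b/c decides how to record such steps in the word.)
[claim: Hu2025, status: under-review]
STATUS: candidate statement under adjudication (D-0012/D-0089); not asserted. -/
abbrev ChartSeq (V : Type v) : Type v := List (ChartStep V)

namespace ChartSeq

variable {R}

/-- The composite pull-back `R[Var_{𝔙_[0]}] → R[Var_𝔙]` along a word of steps (root chart first; for `s :: w` it is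
`(pullback w) ∘ (pullback s)`): Def. 5.1 C34L88–L99
with the substitution of Def. 5.4 C35L26–L29 applied step by step («In general, for sequential blowups …», C35L48–L49).
[claim: Hu2025, status: under-review]
STATUS: candidate statement under adjudication (D-0012/D-0089); not asserted. -/
def pullback (w : ChartSeq V) : MvPolynomial V R →ₐ[R] MvPolynomial V R :=
  w.foldr (fun s φ => φ.comp (s.pullback (R := R))) (AlgHom.id R (MvPolynomial V R))

/-- «𝔙 lies over 𝔙''» (Def. 5.1 C34L95–L99 «Via induction, we say 𝔙 lies over 𝔙'' if 𝔙' equals to (when j = k−1) or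
lies over 𝔙'' (when j < k−1)»): the word of `𝔙''` is a prefix of the word of `𝔙`.
[claim: Hu2025, status: under-review]
STATUS: candidate statement under adjudication (D-0012/D-0089); not asserted. -/
def LiesOver (w w'' : ChartSeq V) : Prop := w'' <+: w

end ChartSeq

/-! ## Prop. 5.3 — the free variables of the chart `𝔙` -/

/-- **Proposition 5.3 (statement C34L146–C35L4, proof C35L6–L8; p.80).** «Keep the notation and assumption as above. In addition, we let E be
the exceptional divisor of the blowup X̃ → X. Then, the standard chart 𝔙 comes equipped with a set of free variables
Var_𝔙 = {ζ, y_1, ⋯, y_m; y := y' ∣ y' ∈ Var_𝔙' ∖ {y_0', ⋯, y_m'}} where ζ := y_0', y_i := ξ_i, i ∈ [m] such that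
• E ∩ 𝔙 = (ζ = 0); we call ζ the exceptional variable/parameter of E on 𝔙; • y_i ∈ Var_𝔙 is a proper transform of
y'_i ∈ Var_𝔙' for all i ∈ [m]; • y ∈ Var_𝔙 is a proper transform of y' ∈ Var_𝔙 [sic: Var_𝔙'] for all
y' ∈ Var_𝔙' ∖ {y_0', ⋯, y_m'}.» Printed proof C35L6–L8: «It is straightforward from (general-blowup-formulas).»
Typed on the fixed index type `V` (the bijection `Var_𝔙' ≅ Var_𝔙` is the identity of indices): the exceptional
ideal is `(ζ)` (= `Def5_1`), and every index other than `exc` is the proper transform (Def. 5.2) of itself. (On the typed carrier this holds for every step by construction of `ChartStep.pullback`/`strictTransform` — a model-consistency statement, not a constraint on the step; kernel check in `Proofs/S05ThetaBlowups/Charts.lean`; lane-B pre-read N1 2026-08-27T06:53Z.)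
[claim: Hu2025, status: under-review]
STATUS: candidate statement under adjudication (D-0012/D-0089); not asserted. -/
def Prop5_3 (s : ChartStep V) : Prop :=
  Def5_1 R s ∧
    (∀ j ∈ s.centre, j ≠ s.exc → s.IsProperTransformVar (R := R) j j) ∧
    (∀ y ∉ s.centre, s.IsProperTransformVar (R := R) y y)

/-! ## Def. 5.4 — proper transforms of binomials (AS PRINTED), of polynomials (AS PRINTED), of ideals (OURS) -/

/-- **`m_{φ,T}` (Def. 5.4, C35L21–L22; p.80).** «We let m_{φ,T^i_𝔙'} = Σ_{j=0}^m deg_{y'_j}(T^i_𝔙'), i = 0, 1» for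
«φ = {y'_0, ⋯, y'_m} ⊂ Var_𝔙'» (C35L15–L17) and a term `T` (a monomial, recorded by its exponent vector; C35L10–L11 «for
every variable x ∈ Var_𝔙, we let deg_x 𝐦 be the degree of x in 𝐦»): the total degree of `T` in the centre's variables.
[claim: Hu2025, status: under-review]
STATUS: candidate statement under adjudication (D-0012/D-0089); not asserted. -/
def phiDeg (φ : Finset V) (T : V →₀ ℕ) : ℕ := ∑ j ∈ φ, T j

/-- **`l_{φ,B}` (Def. 5.4, C35L24; p.80).** «l_{φ,B_𝔙'} = min {m_{φ,T⁰_𝔙'}, m_{φ,T¹_𝔙'}}» for a binomial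
`B_𝔙' = T⁰_𝔙' − T¹_𝔙'` given by the exponent vectors of its two terms.
[claim: Hu2025, status: under-review]
STATUS: candidate statement under adjudication (D-0012/D-0089); not asserted. -/
def lPhi (φ : Finset V) (T₀ T₁ : V →₀ ℕ) : ℕ := min (phiDeg φ T₀) (phiDeg φ T₁)

/-- **A binomial `B = T⁰ − T¹` with variables in `Var` (Def. 5.4 C35L19–L20 «Let B_𝔙' = T⁰_𝔙' − T¹_𝔙' be a binomial
with variables in Var_𝔙'»; §4.2 C22L5–L6 «it suffices to consider binomials 𝐦 − 𝐦'» — both terms MONIC monomials).**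
Typed as the pair of exponent vectors of `T⁰` («plus term») and `T¹` («minus term»; cf. Def. 5.8 «T^±»).
[claim: Hu2025, status: under-review]
STATUS: candidate statement under adjudication (D-0012/D-0089); not asserted. -/
structure Binomial (V : Type v) where
  /-- exponent vector of the term `T⁰` -/
  plus : V →₀ ℕ
  /-- exponent vector of the term `T¹` -/
  minus : V →₀ ℕ

namespace Binomial

variable {R}

/-- The binomial `T⁰ − T¹` as an element of `R[Var]` (Def. 5.4 C35L19–L20).
[claim: Hu2025, status: under-review]
STATUS: candidate statement under adjudication (D-0012/D-0089); not asserted. -/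
def toPoly (B : Binomial V) : MvPolynomial V R := monomial B.plus (1 : R) - monomial B.minus (1 : R)

end Binomial

namespace ChartStep

variable {R}
variable (s : ChartStep V)

/-- **Pull-back of a monomial along the step (Def. 5.4 substitution C35L26–L29, on exponents; p.80).** Under
`y'_j ↦ ζ · y_j` (`j ∈ φ ∖ {i}`), `y'_i ↦ ζ`, `y' ↦ y`, the monomial `x^T` goes to `x^T · ζ^{Σ_{j ∈ φ, j ≠ i} T_j}`:
the exponent of ζ becomes `m_{φ,T}` and all other exponents are kept.
[claim: Hu2025, status: under-review]
STATUS: candidate statement under adjudication (D-0012/D-0089); not asserted. -/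
def pullbackExp (T : V →₀ ℕ) : V →₀ ℕ := T + Finsupp.single s.exc (∑ j ∈ s.centre.erase s.exc, T j)

/-- **Definition 5.4, the binomial case AS PRINTED (C35L13–L36, display (define-proper-t) C35L32–L34; p.80).** «We
then let B_𝔙 = (π^*_{𝔙,𝔙'} B_𝔙') / ζ^{l_{φ,B_𝔙'}}. We call B_𝔙, a binomial in Var_𝔙, the proper transform of B_𝔙'.» Typed
on exponent vectors: both pulled-back terms are divided by `ζ^{l_{φ,B}}` (exact, since the ζ-exponent of each
pulled-back term is its `m_{φ,T} ≥ l_{φ,B}`). This is the TERM-WISE operation the manuscript applies to every listed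
equation (Prop. 5.16, Lem. 7.4 (1)); its relation to the strict transform of the IDEAL of all equations is joint J3
(G-H2) — see `Def5_4_ours`.
[claim: Hu2025, status: under-review]
STATUS: candidate statement under adjudication (D-0012/D-0089); not asserted. -/
def properTransform (B : Binomial V) : Binomial V where
  plus := s.pullbackExp B.plus - Finsupp.single s.exc (lPhi s.centre B.plus B.minus)
  minus := s.pullbackExp B.minus - Finsupp.single s.exc (lPhi s.centre B.plus B.minus)

/-- **Definition 5.4 on polynomials, the same operation (C35L30–L36; p.80).** `(π^* B) / ζ^{l_{φ,B}}` computed in `R[V]`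
with Mathlib's exact monomial division `MvPolynomial.divMonomial`; for the lanes: equals
`(s.properTransform B).toPoly` (kernel fact, not stated here).
[claim: Hu2025, status: under-review]
STATUS: candidate statement under adjudication (D-0012/D-0089); not asserted. -/
def properTransformPoly (B : Binomial V) : MvPolynomial V R :=
  MvPolynomial.divMonomial (s.pullback (R := R) (B.toPoly (R := R)))
    (Finsupp.single s.exc (lPhi s.centre B.plus B.minus))

/-- **Definition 5.4, general polynomials AS PRINTED (C35L38–L42; p.80).** «In general, for any polynomial f_𝔙' in
Var_𝔙' such that f_𝔙' does not vanish identically along Z = (y'_0 = ⋯ = y'_m = 0), we let f_𝔙 = π^*_{𝔙,𝔙'} f_𝔙'.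
This is the pullback, but for convenience, we also call f_𝔙 the proper transform of f_𝔙'.» Typed: the pull-back
(the printed side condition «does not vanish identically along Z», i.e. `f ∉ (y'_0,…,y'_m)`, is the SCOPE in which
the text uses the name; the operation itself is `π^*`).
[claim: Hu2025, status: under-review]
STATUS: candidate statement under adjudication (D-0012/D-0089); not asserted. -/
def properTransformOfPoly (f : MvPolynomial V R) : MvPolynomial V R := s.pullback (R := R) f

/-- **«ζ is acquired by y'_j» (Def. 5.4, last paragraph, C35L44–L49; p.80–81).** «Moreover, suppose ζ appears in
B_𝔙 = (π^* B_𝔙')/ζ^{l_{ψ,B_𝔙'}} [sic: ψ for φ] or in f_𝔙 = π^* f_𝔙', and is obtained through the substitution y'_i by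
y'_0 ξ_i (note here that ζ := y'_0 and i needs not to be unique), then we say that the exceptional parameter ζ is
acquired by y_i'.» Typed for a binomial, TERM-WISE (the occurrence of `y'_j` and the surviving ζ are paired in the SAME
term — «is obtained through the substitution y'_i by y'_0 ξ_i»): `j ∈ φ ∖ {i}` and, for the plus term or for the minus term,
`y'_j` occurs in that term of `B_𝔙'` and ζ still occurs in the corresponding term of the proper transform `B_𝔙` (after the
division by `ζ^{l_{φ,B}}`); «i needs not to be unique». (Reviewer revise p512488 2026-08-27T08:14Z: the earlier cross-term
pairing attributed ζ to a variable whose own ζ-contribution was divided out — witness B = y'_1 − y'_2 y'_3, φ = all, ζ = y'_0: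
B_𝔙 = y_1 − ζ y_2 y_3, so ζ is acquired by y'_2 and y'_3 but not by y'_1.) The transitive closure «for sequential blowups … ζ
is acquired by y''» is bookkeeping along `ChartSeq`, left to files 106b/c.
[claim: Hu2025, status: under-review]
STATUS: candidate statement under adjudication (D-0012/D-0089); not asserted. -/
def AcquiredBy (B : Binomial V) (j : V) : Prop :=
  j ∈ s.centre ∧ j ≠ s.exc ∧
    ((0 < B.plus j ∧ 0 < (s.properTransform B).plus s.exc) ∨ (0 < B.minus j ∧ 0 < (s.properTransform B).minus s.exc))

end ChartStep

/-- **Definition 5.4 (binomial case) under its printed name: `Def5_4 R s B` = the proper transform `B_𝔙 ∈ R[Var_𝔙]`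
of the binomial `B = B_𝔙'` along the step `s` (C35L13–L36; p.80).** Alias of `ChartStep.properTransformPoly`.
[claim: Hu2025, status: under-review]
STATUS: candidate statement under adjudication (D-0012/D-0089); not asserted. -/
abbrev Def5_4 (s : ChartStep V) (B : Binomial V) : MvPolynomial V R := s.properTransformPoly (R := R) B

/-- **Definition 5.4 (general polynomial) under its printed name (C35L38–L42; p.80).** Alias of
`ChartStep.properTransformOfPoly` (= the pull-back, AS PRINTED).
[claim: Hu2025, status: under-review]
STATUS: candidate statement under adjudication (D-0012/D-0089); not asserted. -/
abbrev Def5_4_poly (s : ChartStep V) (f : MvPolynomial V R) : MvPolynomial V R := s.properTransformOfPoly (R := R) f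

/-- **Definition 5.4 — OURS sibling (T5 / PARTITION-HU §6 (e); what joint J3 = G-H2 reads next to `Def5_4`).** For a
SET of equations `E' ⊆ R[Var_𝔙']` cutting out a closed subscheme `V(E') ∩ 𝔙'`, the honest chart ideal of its proper
(= strict) transform in `𝔙` is the ζ-saturation of the total transform of the IDEAL `(E')`:
`Def5_4_ours R s E' = ⋃ₙ ((π^* E') · R[Var_𝔙] : ζⁿ)` (`ChartStep.strictTransform`). The manuscript instead lists the
term-wise proper transforms `{Def5_4 R s B : B ∈ E'}` (Prop. 5.16 C38L124 ff.; Lem. 7.4 (1) C60L3–L14 with C60L75–L79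
«We then take the proper transforms of these equations …»); `Ideal.span` of that list is always CONTAINED in this
ideal; equality is the inference adjudicated at J3. OURS — labelled as such, not attributed to [Hu25] (the source's
operation is `Def5_4`); the claim tag below marks the source under adjudication, as for every `_ours` sibling (T5).
[claim: Hu2025, status: under-review]
STATUS: candidate statement under adjudication (D-0012/D-0089); not asserted — OURS comparison reading. -/
def Def5_4_ours (s : ChartStep V) (E' : Set (MvPolynomial V R)) : Ideal (MvPolynomial V R) :=
  s.strictTransform (R := R) (Ideal.span E')

/-! ## Lem. 5.5, Def. 5.6 -/

/-- **Lemma 5.5 (statement C35L51–L59, proof C35L61–L63; p.81; the header prints «Lemmminglea 5.5.» — sic, a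
theorem-environment name typo recorded in lit/PARTITION-HU.md §0).** «We keep the same assumption and notation as in
Definition (general-proper-transforms) [= Def. 5.4]. We let T_{𝔙',B} (resp. T_{𝔙,B}) be any fixed term of B_𝔙'
(resp. B_𝔙). Consider any y ∈ Var_𝔙 ∖ ζ and let y' ∈ Var_𝔙' be such that y is the proper transform of y'. Then,
y^b ∣ T_{𝔙,B} if and only if y'^b ∣ T_{𝔙',B} for all integers b ≥ 0.» Printed proof: «This is clear from
(define-proper-t).» Typed with «any fixed term … resp.» read as CORRESPONDING terms (T⁰ ↔ its transform, T¹ ↔ its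
transform) and `y` = the index `y' ≠ exc` (Prop. 5.3): divisibility of a monic monomial by `y^b` is `b ≤` its
`y`-exponent, so the statement is the equality of the `y`-exponents before and after the step, for both terms. (On the typed carrier this holds for every step by construction of `ChartStep.pullbackExp` — a model-consistency statement, not a constraint on the step; kernel check in `Proofs/S05ThetaBlowups/Charts.lean`; lane-B pre-read N1 2026-08-27T06:53Z.)
[claim: Hu2025, status: under-review]
STATUS: candidate statement under adjudication (D-0012/D-0089); not asserted. -/
def Lem5_5 (s : ChartStep V) (B : Binomial V) : Prop :=
  ∀ y : V, y ≠ s.exc → ∀ b : ℕ,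
    (b ≤ (s.properTransform B).plus y ↔ b ≤ B.plus y) ∧ (b ≤ (s.properTransform B).minus y ↔ b ≤ B.minus y)

namespace Binomial

variable {R}

/-- **Definition 5.6 (C35L65–L76; p.81).** «Consider an arbitrary binomial B_𝔙' (resp. B_𝔙) with variables in Var_𝔙'
(resp. Var_𝔙). Let 𝐳' ∈ 𝔙' (resp. 𝐳 ∈ 𝔙) be any fixed closed point of the chart. We say B_𝔙' (resp. B_𝔙)
terminates at 𝐳' (resp. 𝐳) if (at least) one of the monomial terms of B_𝔙' (resp. B_𝔙), say, T_{𝔙',B} (resp.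
T_{𝔙,B}), does not vanish at 𝐳' (resp. 𝐳). In such a case, we also say T_{𝔙',B} (resp. T_{𝔙,B}) terminates at 𝐳'
(resp. 𝐳).» Typed for one chart (the «resp.» clause is the same predicate on the other chart): a closed point of the
chart ↦ a maximal ideal `𝔪` of `R[Var]` (module docstring); «T does not vanish at 𝐳» ↦ `T ∉ 𝔪`.
[claim: Hu2025, status: under-review]
STATUS: candidate statement under adjudication (D-0012/D-0089); not asserted. -/
def TerminatesAt (B : Binomial V) (𝔪 : Ideal (MvPolynomial V R)) : Prop :=
  𝔪.IsMaximal ∧ (monomial B.plus (1 : R) ∉ 𝔪 ∨ monomial B.minus (1 : R) ∉ 𝔪)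

/-- Def. 5.6, the term form (C35L73–L76): «we also say T_{𝔙,B} terminates at 𝐳» — the term `x^T` does not vanish at
the closed point `𝔪`.
[claim: Hu2025, status: under-review]
STATUS: candidate statement under adjudication (D-0012/D-0089); not asserted. -/
def TermTerminatesAt (T : V →₀ ℕ) (𝔪 : Ideal (MvPolynomial V R)) : Prop :=
  𝔪.IsMaximal ∧ monomial T (1 : R) ∉ 𝔪

end Binomial

/-- **Definition 5.6 under its printed name:** `Def5_6 R B 𝔪` = «the binomial `B` terminates at the closed point `𝔪`
of its chart» (C35L65–L76; p.81). Alias of `Binomial.TerminatesAt`.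
[claim: Hu2025, status: under-review]
STATUS: candidate statement under adjudication (D-0012/D-0089); not asserted. -/
abbrev Def5_6 (B : Binomial V) (𝔪 : Ideal (MvPolynomial V R)) : Prop := B.TerminatesAt (R := R) 𝔪

end Literature.AlgebraicGeometry.Hu2025.Statements.S05ThetaBlowups

end
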